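import Mathlib
import HarnessLib
import Summits.HubbardSuperconductivity.HubbardSuperconductivity.Theorems.KLProgrammeKLRegimeEnginePairTransferPHCrossedSignedGeneric
import Summits.HubbardSuperconductivity.HubbardSuperconductivity.Theorems.KLProgrammeKLRegimeEnginePairTransferMemberPHSignedRoom
import Summits.HubbardSuperconductivity.HubbardSuperconductivity.Theorems.KLProgrammeKLRegimeEngineV8PairTransferRelBarIdx

/-!
# Route `KLProgramme` — ENGINE item stmt-HubbardSuperconductivity-20437 `KLRegimeEngineV17F2`, class-#5 STEP (X).3 rows form: the PINNED PAIR's `D`-rows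
# `Rd₁ / Rx₁` (`D = s_{n+1,j} − s_{n+1,n+1}`, pair `(s_{n+1,j} | 0)`) in the FORWARD WINDOW — the signed rows REDUCED TO `j = n+2` and READ in the ROOM's
# `(4ⁿ⁺¹)⁻¹·ov / 3·thermalBar / min / 1/L` monomials (cell gate-hubbard-kl, seat hubbard-kl-k3c2-p2 g20, technique «thermal-bar induction n ≤ nScales β + 1»;
# located item «(X).3-D-EDGE» (3) of k3c1-p1 g16 / CLASS5-RESOLVED-STEP.md §13, forward half; tail half = `…DLineEdgeTwoShell` / `…DLineEdgeRoomReading`)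

WHY.  At the pinned pair the `D`-line `s_{n+1,j}` meets the slice band for `t > 2/3`: below the leg-transfer threshold the sign-blind `D`-masses have no gain and the
ROWS door (`hd₁ hx₁` signed, gen 17's `klms_dLine_adjacent_direct/crossed_signed_le`) is the way in.  Those rows are keyed on the FAR index `j` (constants
`(Λₙ₊₁/Λ_j)²`, `16^{j−(n+1)}`), useless for deep `j`; but in the window the deep part `s_{n+1,j} − s_{n+1,n+2}` of `D` never meets the slice, so the literal sums at
`j` and at `n+2` COINCIDE (`klms_weighted_direct_eq_near`, §1 `klms_weighted_crossed_eq_near`) and the row is read at `j = n+2` (`(Λₙ₊₁/Λₙ₊₂)² = 16¹ = 16`):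
* §2 **`dLine_pinned_direct_signed_le`** (`n+2 ≤ j`, window `G|p_{x−y}|_𝕋 ≤ Λₙ₊₁/8`) / **`dLine_pinned_crossed_signed_le`** (window `G|p_{Q_m−x−y}|_𝕋 ≤ Λₙ₊₁/16`,
  `16π/β ≤ Λₙ₊₁`): literal `hd₁`/`hx₁` sums `≤ (βL²)²·(βL²·Row_{n+2}(δ⁺) + βL²·Row_{n+2}(δ⁻)) + ε·flat(s_{n+1,n+2} − s_{n+1,n+1})`,
  `Row_{n+2}(δ) = klmsRowBound Dt_min A G A₀ L_A β n (n+2) δ L`, kernel data `(A₀, L_A, ε)` of `V_j(t)` as in the signed rows;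
* §3 `klSoftMass_pinned_near_le` (`≤ 15367/4 = klIdxMass n (n+1)`), **`pinned_flat_le`** (ε-remainder `≤ ε·512·15367` in the door's normalisation),
  **`pinned_rowBound_reading`** (`(Λₙ−Λₙ₊₁)·Row_{n+2}(δ) = (3/2π)(ZS⋆Λₙ₊₁ + TH⋆(π/β)/Λₙ₊₁ + TR⋆(|0|+δ)/Λₙ₊₁) + LAT⋆/L`, closed `Λ`-free `ZS⋆ TH⋆ TR⋆`),
  **`pinned_row_le_slots`** (`δ = G·r`, `r ≤ Λₙ₊₁`, `n ≤ n_β`): `2(Λₙ−Λₙ₊₁)Row_{n+2}(Gr) ≤ (3/π)ZS⋆·klE0·(4ⁿ⁺¹)⁻¹ + (12/π)TH⋆·(4^{n_β−n})⁻¹ + (3/π)TR⋆·G·min(r/Λₙ₊₁, Λₙ₊₁/r)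
  + 2LAT⋆/L` = the ROOM's `(4ⁿ⁺¹)⁻¹·klIdxOverlap (n+1)(n+1)`, `3·thermalBar (n+1)`, `min_d`, `1/L` monomials (`transferBarRelIdx_succ_room`); `…_shift` for `δ = 2π/β + G·r`.
LOCATED («(X).3-D-EDGE-FORWARD», pen / k3c1-p1 / class #1): the pinned pair's forward window closes ONLY modulo the kernel data `(A₀, L_A, ε)` of the class-#5 kernel
`V_j(t)` with `A₀, L_A` FLAT in `n` (in-class twin of «(c)-OUT-PH-FLAT» / «(E4)-DRESSED-MOMENTS») and an `L`-threshold for `LAT⋆/L` (`∝ L_A/Λₙ₊₁ + A₀G/Λₙ₊₁²`).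
Pure composition/arithmetic; nothing about the model's effective action is asserted; nothing asserts (X).3, (c), K3 or superconductivity.  0 kit · 0 lit.
-/

noncomputable section

namespace Summit.HubbardSuperconductivity.HubbardSuperconductivity.Theorems.KLRegimeSplit

set_option linter.dupNamespace false -- summit = problem name (single-conjunct summit), D-0017

open Real Set Finset Complex Literature.MathematicalPhysics.QuantumLattice
open Literature.Probability.LatticeModels hiding torusSupNorm
open Literature.MathematicalPhysics.QuantumLattice.BandSectorCounting
open Summit.HubbardSuperconductivity.HubbardSuperconductivity.Theorems.KLProgrammeLegKernels
open Summit.HubbardSuperconductivity.HubbardSuperconductivity.Theorems.KLRegimeWick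
open Summit.HubbardSuperconductivity.HubbardSuperconductivity.Theorems.TwoPointAssembly
open Summit.HubbardSuperconductivity.HubbardSuperconductivity.Theorems.DispersionFlow
open Summit.HubbardSuperconductivity.HubbardSuperconductivity.Theorems.PerturbedFermiCurve

variable {L M : ℕ} [NeZero L] [NeZero M] (β μ : ℝ) (K : TrigPolyC4v)

/-! ## §1 The crossed sum at small transfer does not see the deep part of the weight -/

/-- Two partner weights differing by the deep `D`-line `s_{n+1,j} − s_{n+1,n+2}` (`n+2 ≤ j`) give the same literal CROSSED sum at small transfer
`G|p_{Q_m−x−y}|_𝕋 ≤ Λ(t)/13` (`16π/β ≤ Λₙ₊₁`; every term of the difference has a vanishing line factor, `crossed_DLine_factors_eq_zero`). -/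
theorem klms_weighted_crossed_eq_near {R : RenConsts} (hR : ∀ j, 0 ≤ R.Gfr j) {U : ℝ} {N : ℕ} (hK : FrameOK R U N μ K) (hβ : 0 < β) (n : ℕ)
    (hβn : 16 * π / β ≤ klScale klE0 (n + 1)) {j : ℕ} (hj : n + 2 ≤ j) {t : ℝ} (ht : t ∈ Icc (0 : ℝ) 1) {Qm x y : TorusSite 2 L}
    (hq : (4 + 8 / 3 * R.Gfr 1 * U ^ 2) * klTorusNorm L (Qm - x - y) ≤ (klScale klE0 n + t * (klScale klE0 (n + 1) - klScale klE0 n)) / 13)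
    (w w' : FreqMomentum L M → ℝ)
    (hdiff : ∀ k : FreqMomentum L M, w k = w' k + (softSymbolCompl L M β μ K (n + 1) j k - softSymbolCompl L M β μ K (n + 1) (n + 2) k))
    (Wd : ℝ → FreqMomentum L M → ℝ) (hWd : Wd = fun t k => deriv (fun Λ' : ℝ => hubbardCutoffWeightCT L M β μ K Λ' k) (klScale klE0 n + t * (klScale klE0 (n + 1) - klScale klE0 n)))
    (F : FreqMomentum L M → FreqMomentum L M → ℂ) :
    (∑ p : FreqMomentum L M, ∑ p' : FreqMomentum L M,
        if matsubaraInt M p'.1 + matsubaraInt M (omega0 M) + matsubaraInt M (omega0 M) + 1 = matsubaraInt M p.1 ∧ p'.2 = p.2 + Qm - x - y then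
          ((((((w p) : ℝ) : ℂ) * (((β * (L : ℝ) ^ 2 : ℝ) : ℂ) * propCT L M β μ K p)) * ((((Wd t p') : ℝ) : ℂ) * (((β * (L : ℝ) ^ 2 : ℝ) : ℂ) * propCT L M β μ K p'))) +
              (((((Wd t p) : ℝ) : ℂ) * (((β * (L : ℝ) ^ 2 : ℝ) : ℂ) * propCT L M β μ K p)) * ((((w p') : ℝ) : ℂ) * (((β * (L : ℝ) ^ 2 : ℝ) : ℂ) * propCT L M β μ K p')))) *
            F p p'
        else 0) =
      ∑ p : FreqMomentum L M, ∑ p' : FreqMomentum L M,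
        if matsubaraInt M p'.1 + matsubaraInt M (omega0 M) + matsubaraInt M (omega0 M) + 1 = matsubaraInt M p.1 ∧ p'.2 = p.2 + Qm - x - y then
          ((((((w' p) : ℝ) : ℂ) * (((β * (L : ℝ) ^ 2 : ℝ) : ℂ) * propCT L M β μ K p)) * ((((Wd t p') : ℝ) : ℂ) * (((β * (L : ℝ) ^ 2 : ℝ) : ℂ) * propCT L M β μ K p'))) +
              (((((Wd t p) : ℝ) : ℂ) * (((β * (L : ℝ) ^ 2 : ℝ) : ℂ) * propCT L M β μ K p)) * ((((w' p') : ℝ) : ℂ) * (((β * (L : ℝ) ^ 2 : ℝ) : ℂ) * propCT L M β μ K p')))) *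
            F p p'
        else 0 := by
  rw [← sub_eq_zero, ← Finset.sum_sub_distrib]
  refine Finset.sum_eq_zero fun p _ => ?_
  rw [← Finset.sum_sub_distrib]
  refine Finset.sum_eq_zero fun p' _ => ?_
  split_ifs with hc
  · obtain ⟨hω, hk⟩ := hc
    have hω' : matsubaraInt M p'.1 + 1 = matsubaraInt M p.1 := by simpa [matsubaraInt_omega0] using hω
    obtain ⟨h1, h2⟩ := crossed_DLine_factors_eq_zero β μ K hR hK hβ n hβn le_rfl hj ht hq hω' hk
    have hW : ∀ k : FreqMomentum L M,
        Wd t k = deriv (fun Λ' : ℝ => hubbardCutoffWeightCT L M β μ K Λ' k) (klScale klE0 n + t * (klScale klE0 (n + 1) - klScale klE0 n)) := by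
      intro k; simp only [hWd]
    rw [← hW p'] at h1; rw [← hW p] at h2
    have h1c := congrArg (fun r : ℝ => (r : ℂ)) h1
    have h2c := congrArg (fun r : ℝ => (r : ℂ)) h2
    push_cast at h1c h2c
    rw [sub_eq_zero, hdiff p, hdiff p']
    push_cast
    linear_combination ((β : ℂ) ^ 2 * (L : ℂ) ^ 4 * propCT L M β μ K p * propCT L M β μ K p' * F p p') * h1c +
      ((β : ℂ) ^ 2 * (L : ℂ) ^ 4 * propCT L M β μ K p * propCT L M β μ K p' * F p p') * h2c
  · simp

/-! ## §2 The pinned pair's `D`-rows in the forward window, read at `j = n+2` -/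

section Pinned

variable {a' b' : ℝ} (B : BandBounds a' b') {R : RenConsts} {U : ℝ} {N : ℕ} {A : ℝ}

/-- **THE PINNED PAIR's DIRECT `D`-ROW `Rd₁` IN THE FORWARD WINDOW** (`n + 2 ≤ j`, `G|p_{x−y}|_𝕋 ≤ Λₙ₊₁/8`): the literal `hd₁` sum of `klmd_defectDiff_le_rows_family` at
`j′ := n+1` is bounded by the signed row AT INDEX `n+2` — `(βL²)²·(βL²·Row_{n+2}(G|p_{x−y}|) + βL²·Row_{n+2}(G|p_{x−y}|)) + ε·(512/3)(βL²)²/Λ(t)²·Σ|s_{n+1,n+2} − s_{n+1,n+1}|‖ĝ‖`;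
kernel data `(A₀, L_A, ε)` of `V_j(t)` exactly as in `klms_dLine_adjacent_direct_signed_le`. -/
theorem dLine_pinned_direct_signed_le (hR : ∀ j, 0 ≤ R.Gfr j) (hK : FrameOK R U N μ K)
    (hAb : ∀ p : Momentum, ∀ j ≤ 2, ‖iteratedFDeriv ℝ j (frameShift K) p‖ ≤ A) (hA : 4 * A < B.Dtmin) (hA20 : 4 * A ≤ 1 / 20) (hμ : μ ≤ -0.15)
    (n : ℕ) {t : ℝ} (ht : t ∈ Icc (0 : ℝ) 1) (hβ : klBetaMin ≤ β) (hn : n + 1 ≤ nScales β + 1)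
    (hM : β * (4 * klScale klE0 (n + 1)) / (2 * Real.pi) + 1 ≤ M)
    (Wd : ℝ → FreqMomentum L M → ℝ) (hWd : Wd = fun t k => deriv (fun Λ' : ℝ => hubbardCutoffWeightCT L M β μ K Λ' k) (klScale klE0 n + t * (klScale klE0 (n + 1) - klScale klE0 n)))
    (V : ℕ → ℝ → (Fin 4 → HubbardFieldIdx L M) → ℂ) {j : ℕ} (hj : n + 2 ≤ j) (Qm x y : TorusSite 2 L)
    (hlo : a' < μ - 4 * klScale klE0 (n + 1) - 4 * A) (hhi : μ + 4 * klScale klE0 (n + 1) + 4 * A < b')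
    (hq : (4 + 8 / 3 * R.Gfr 1 * U ^ 2) * klTorusNorm L (x - y) ≤ klScale klE0 (n + 1) / 8)
    {A₀ LA ε : ℝ} (hA0 : 0 ≤ A₀) (hLA : 0 ≤ LA) (hε : 0 ≤ ε)
    (hY0p : ∀ k : TorusSite 2 L, ‖∑ σ : Fin 2, V j t ![(((omega0 M, k), σ), 1), (((omega0 M, k + (x - y)), σ), 0), (((omega0 M, y), 0), 0), (((omega0 M, x), 0), 1)] *
        V j t ![(((omega0 M, k), σ), 0), (((omega0 M, k + (x - y)), σ), 1), ((((omega0 M).rev, Qm - y), 1), 0), ((((omega0 M).rev, Qm - x), 1), 1)]‖ ≤ A₀)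
    (hY1p : ∀ k k' : TorusSite 2 L, ‖(∑ σ : Fin 2, V j t ![(((omega0 M, k), σ), 1), (((omega0 M, k + (x - y)), σ), 0), (((omega0 M, y), 0), 0), (((omega0 M, x), 0), 1)] *
          V j t ![(((omega0 M, k), σ), 0), (((omega0 M, k + (x - y)), σ), 1), ((((omega0 M).rev, Qm - y), 1), 0), ((((omega0 M).rev, Qm - x), 1), 1)]) -
        ∑ σ : Fin 2, V j t ![(((omega0 M, k'), σ), 1), (((omega0 M, k' + (x - y)), σ), 0), (((omega0 M, y), 0), 0), (((omega0 M, x), 0), 1)] *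
          V j t ![(((omega0 M, k'), σ), 0), (((omega0 M, k' + (x - y)), σ), 1), ((((omega0 M).rev, Qm - y), 1), 0), ((((omega0 M).rev, Qm - x), 1), 1)]‖ ≤
        LA * klTorusNorm L (k - k'))
    (hY0m : ∀ k : TorusSite 2 L, ‖∑ σ : Fin 2, V j t ![(((omega0 M, k + -(x - y)), σ), 1), (((omega0 M, k), σ), 0), (((omega0 M, y), 0), 0), (((omega0 M, x), 0), 1)] *
        V j t ![(((omega0 M, k + -(x - y)), σ), 0), (((omega0 M, k), σ), 1), ((((omega0 M).rev, Qm - y), 1), 0), ((((omega0 M).rev, Qm - x), 1), 1)]‖ ≤ A₀)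
    (hY1m : ∀ k k' : TorusSite 2 L, ‖(∑ σ : Fin 2, V j t ![(((omega0 M, k + -(x - y)), σ), 1), (((omega0 M, k), σ), 0), (((omega0 M, y), 0), 0), (((omega0 M, x), 0), 1)] *
          V j t ![(((omega0 M, k + -(x - y)), σ), 0), (((omega0 M, k), σ), 1), ((((omega0 M).rev, Qm - y), 1), 0), ((((omega0 M).rev, Qm - x), 1), 1)]) -
        ∑ σ : Fin 2, V j t ![(((omega0 M, k' + -(x - y)), σ), 1), (((omega0 M, k'), σ), 0), (((omega0 M, y), 0), 0), (((omega0 M, x), 0), 1)] *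
          V j t ![(((omega0 M, k' + -(x - y)), σ), 0), (((omega0 M, k'), σ), 1), ((((omega0 M).rev, Qm - y), 1), 0), ((((omega0 M).rev, Qm - x), 1), 1)]‖ ≤
        LA * klTorusNorm L (k - k'))
    (hflat : ∀ (i : MatsubaraIdx M) (σ : Fin 2) (k k' : TorusSite 2 L), matsubaraFreq β M i ^ 2 ≤ (4 * klScale klE0 (n + 1)) ^ 2 →
      ‖V j t ![(((i, k), σ), 1), (((i, k'), σ), 0), (((omega0 M, y), 0), 0), (((omega0 M, x), 0), 1)] *
            V j t ![(((i, k), σ), 0), (((i, k'), σ), 1), ((((omega0 M).rev, Qm - y), 1), 0), ((((omega0 M).rev, Qm - x), 1), 1)] -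
          V j t ![(((omega0 M, k), σ), 1), (((omega0 M, k'), σ), 0), (((omega0 M, y), 0), 0), (((omega0 M, x), 0), 1)] *
            V j t ![(((omega0 M, k), σ), 0), (((omega0 M, k'), σ), 1), ((((omega0 M).rev, Qm - y), 1), 0), ((((omega0 M).rev, Qm - x), 1), 1)]‖ ≤ ε) :
    ‖∑ p : FreqMomentum L M, ∑ σ : Fin 2, ∑ p' : FreqMomentum L M,
        if matsubaraInt M p'.1 + matsubaraInt M (omega0 M) = matsubaraInt M p.1 + matsubaraInt M (omega0 M) ∧ p'.2 = p.2 + x - y then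
          ((((((softSymbolCompl L M β μ K (n + 1) j p - softSymbolCompl L M β μ K (n + 1) (n + 1) p) : ℝ) : ℂ) * (((β * (L : ℝ) ^ 2 : ℝ) : ℂ) * propCT L M β μ K p)) *
                ((((Wd t p') : ℝ) : ℂ) * (((β * (L : ℝ) ^ 2 : ℝ) : ℂ) * propCT L M β μ K p'))) +
              (((((Wd t p) : ℝ) : ℂ) * (((β * (L : ℝ) ^ 2 : ℝ) : ℂ) * propCT L M β μ K p)) *
                ((((softSymbolCompl L M β μ K (n + 1) j p' - softSymbolCompl L M β μ K (n + 1) (n + 1) p') : ℝ) : ℂ) * (((β * (L : ℝ) ^ 2 : ℝ) : ℂ) * propCT L M β μ K p')))) *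
            (V j t ![((p, σ), 1), ((p', σ), 0), (((omega0 M, y), 0), 0), (((omega0 M, x), 0), 1)] *
              V j t ![((p, σ), 0), ((p', σ), 1), ((((omega0 M).rev, Qm - y), 1), 0), ((((omega0 M).rev, Qm - x), 1), 1)])
        else 0‖ ≤
      (β * (L : ℝ) ^ 2) ^ 2 *
          (β * (L : ℝ) ^ 2 * klmsRowBound B.Dtmin A (4 + 8 / 3 * R.Gfr 1 * U ^ 2) A₀ LA β n (n + 2) ((4 + 8 / 3 * R.Gfr 1 * U ^ 2) * klTorusNorm L (x - y)) L +
            β * (L : ℝ) ^ 2 * klmsRowBound B.Dtmin A (4 + 8 / 3 * R.Gfr 1 * U ^ 2) A₀ LA β n (n + 2) ((4 + 8 / 3 * R.Gfr 1 * U ^ 2) * klTorusNorm L (x - y)) L) +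
        ε * (512 / 3 * (β * (L : ℝ) ^ 2) ^ 2 / (klScale klE0 n + t * (klScale klE0 (n + 1) - klScale klE0 n)) ^ 2 *
          ∑ p : FreqMomentum L M, |softSymbolCompl L M β μ K (n + 1) (n + 2) p - softSymbolCompl L M β μ K (n + 1) (n + 1) p| * ‖propCT L M β μ K p‖) := by
  have hβ0 : 0 < β := lt_of_lt_of_le (by norm_num [klBetaMin]) hβ
  have hΛ1 := klth_klScale_pos (n + 1)
  -- the window is inside the reduction threshold `Λ(t)/6`
  have hq' : (4 + 8 / 3 * R.Gfr 1 * U ^ 2) * klTorusNorm L (x - y) ≤ (klScale klE0 n + t * (klScale klE0 (n + 1) - klScale klE0 n)) / 6 := by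
    have := (scaleAt_mem n ht).1; linarith
  -- (1) replace `s_{n+1,j}` by `s_{n+1,n+2}` in the literal sum
  rw [klms_weighted_direct_eq_near β μ K hR hK n hj ht hq'
    (fun p => softSymbolCompl L M β μ K (n + 1) j p - softSymbolCompl L M β μ K (n + 1) (n + 1) p)
    (fun p => softSymbolCompl L M β μ K (n + 1) (n + 2) p - softSymbolCompl L M β μ K (n + 1) (n + 1) p) (fun k => by ring) Wd hWd]
  -- (2) the signed adjacent row at index `n+2` with the kernel `V_j(t)`
  exact klms_dLine_adjacent_direct_signed_le β μ K B hR hK hAb hA hA20 hμ n ht hβ hn hM Wd hWd (fun _ => V j) (j := n + 2) (by omega) Qm x y hlo hhi hq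
    hA0 hLA hε hY0p hY1p hY0m hY1m hflat

/-- **THE PINNED PAIR's CROSSED `D`-ROW `Rx₁` IN THE FORWARD WINDOW** (`n + 2 ≤ j`, `G|p_{Q_m−x−y}|_𝕋 ≤ Λₙ₊₁/16`, `16π/β ≤ Λₙ₊₁`): the literal `hx₁` sum of
`klmd_defectDiff_le_rows_family` at `j′ := n+1`, read at index `n+2` (transfer shifts `|∓2π/β|` in the row's `δ`). -/
theorem dLine_pinned_crossed_signed_le (hR : ∀ j, 0 ≤ R.Gfr j) (hK : FrameOK R U N μ K)
    (hAb : ∀ p : Momentum, ∀ j ≤ 2, ‖iteratedFDeriv ℝ j (frameShift K) p‖ ≤ A) (hA : 4 * A < B.Dtmin) (hA20 : 4 * A ≤ 1 / 20) (hμ : μ ≤ -0.15)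
    (n : ℕ) {t : ℝ} (ht : t ∈ Icc (0 : ℝ) 1) (hβ : klBetaMin ≤ β) (hn : n + 1 ≤ nScales β + 1) (hβn : 16 * π / β ≤ klScale klE0 (n + 1))
    (hM : β * (4 * klScale klE0 (n + 1)) / (2 * Real.pi) + 1 ≤ M)
    (Wd : ℝ → FreqMomentum L M → ℝ) (hWd : Wd = fun t k => deriv (fun Λ' : ℝ => hubbardCutoffWeightCT L M β μ K Λ' k) (klScale klE0 n + t * (klScale klE0 (n + 1) - klScale klE0 n)))
    (V : ℕ → ℝ → (Fin 4 → HubbardFieldIdx L M) → ℂ) {j : ℕ} (hj : n + 2 ≤ j) (Qm x y : TorusSite 2 L)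
    (hlo : a' < μ - 4 * klScale klE0 (n + 1) - 4 * A) (hhi : μ + 4 * klScale klE0 (n + 1) + 4 * A < b')
    (hq : (4 + 8 / 3 * R.Gfr 1 * U ^ 2) * klTorusNorm L (Qm - x - y) ≤ klScale klE0 (n + 1) / 16)
    {A₀ LA ε : ℝ} (hA0 : 0 ≤ A₀) (hLA : 0 ≤ LA) (hε : 0 ≤ ε)
    (hY0B : ∀ k : TorusSite 2 L, ‖V j t ![(((omega0 M, k), 0), 1), ((((omega0 M).rev, k + (Qm - x - y)), 1), 0), (((omega0 M, y), 0), 0), ((((omega0 M).rev, Qm - x), 1), 1)] *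
        V j t ![(((omega0 M, k), 0), 0), ((((omega0 M).rev, k + (Qm - x - y)), 1), 1), ((((omega0 M).rev, Qm - y), 1), 0), (((omega0 M, x), 0), 1)]‖ ≤ A₀)
    (hY1B : ∀ k k' : TorusSite 2 L,
      ‖V j t ![(((omega0 M, k), 0), 1), ((((omega0 M).rev, k + (Qm - x - y)), 1), 0), (((omega0 M, y), 0), 0), ((((omega0 M).rev, Qm - x), 1), 1)] *
            V j t ![(((omega0 M, k), 0), 0), ((((omega0 M).rev, k + (Qm - x - y)), 1), 1), ((((omega0 M).rev, Qm - y), 1), 0), (((omega0 M, x), 0), 1)] -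
          V j t ![(((omega0 M, k'), 0), 1), ((((omega0 M).rev, k' + (Qm - x - y)), 1), 0), (((omega0 M, y), 0), 0), ((((omega0 M).rev, Qm - x), 1), 1)] *
            V j t ![(((omega0 M, k'), 0), 0), ((((omega0 M).rev, k' + (Qm - x - y)), 1), 1), ((((omega0 M).rev, Qm - y), 1), 0), (((omega0 M, x), 0), 1)]‖ ≤
        LA * klTorusNorm L (k - k'))
    (hY0A : ∀ k : TorusSite 2 L, ‖V j t ![(((omega0 M, k + -(Qm - x - y)), 0), 1), ((((omega0 M).rev, k), 1), 0), (((omega0 M, y), 0), 0), ((((omega0 M).rev, Qm - x), 1), 1)] *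
        V j t ![(((omega0 M, k + -(Qm - x - y)), 0), 0), ((((omega0 M).rev, k), 1), 1), ((((omega0 M).rev, Qm - y), 1), 0), (((omega0 M, x), 0), 1)]‖ ≤ A₀)
    (hY1A : ∀ k k' : TorusSite 2 L,
      ‖V j t ![(((omega0 M, k + -(Qm - x - y)), 0), 1), ((((omega0 M).rev, k), 1), 0), (((omega0 M, y), 0), 0), ((((omega0 M).rev, Qm - x), 1), 1)] *
            V j t ![(((omega0 M, k + -(Qm - x - y)), 0), 0), ((((omega0 M).rev, k), 1), 1), ((((omega0 M).rev, Qm - y), 1), 0), (((omega0 M, x), 0), 1)] -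
          V j t ![(((omega0 M, k' + -(Qm - x - y)), 0), 1), ((((omega0 M).rev, k'), 1), 0), (((omega0 M, y), 0), 0), ((((omega0 M).rev, Qm - x), 1), 1)] *
            V j t ![(((omega0 M, k' + -(Qm - x - y)), 0), 0), ((((omega0 M).rev, k'), 1), 1), ((((omega0 M).rev, Qm - y), 1), 0), (((omega0 M, x), 0), 1)]‖ ≤
        LA * klTorusNorm L (k - k'))
    (hflat : ∀ (i i' : MatsubaraIdx M) (k k' : TorusSite 2 L), matsubaraInt M i' + 1 = matsubaraInt M i →
      matsubaraFreq β M i ^ 2 ≤ (5 * klScale klE0 (n + 1)) ^ 2 →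
      ‖V j t ![(((i, k), 0), 1), (((i', k'), 1), 0), (((omega0 M, y), 0), 0), ((((omega0 M).rev, Qm - x), 1), 1)] *
            V j t ![(((i, k), 0), 0), (((i', k'), 1), 1), ((((omega0 M).rev, Qm - y), 1), 0), (((omega0 M, x), 0), 1)] -
          V j t ![(((omega0 M, k), 0), 1), ((((omega0 M).rev, k'), 1), 0), (((omega0 M, y), 0), 0), ((((omega0 M).rev, Qm - x), 1), 1)] *
            V j t ![(((omega0 M, k), 0), 0), ((((omega0 M).rev, k'), 1), 1), ((((omega0 M).rev, Qm - y), 1), 0), (((omega0 M, x), 0), 1)]‖ ≤ ε) :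
    ‖∑ p : FreqMomentum L M, ∑ p' : FreqMomentum L M,
        if matsubaraInt M p'.1 + matsubaraInt M (omega0 M) + matsubaraInt M (omega0 M) + 1 = matsubaraInt M p.1 ∧ p'.2 = p.2 + Qm - x - y then
          ((((((softSymbolCompl L M β μ K (n + 1) j p - softSymbolCompl L M β μ K (n + 1) (n + 1) p) : ℝ) : ℂ) * (((β * (L : ℝ) ^ 2 : ℝ) : ℂ) * propCT L M β μ K p)) *
                ((((Wd t p') : ℝ) : ℂ) * (((β * (L : ℝ) ^ 2 : ℝ) : ℂ) * propCT L M β μ K p'))) +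
              (((((Wd t p) : ℝ) : ℂ) * (((β * (L : ℝ) ^ 2 : ℝ) : ℂ) * propCT L M β μ K p)) *
                ((((softSymbolCompl L M β μ K (n + 1) j p' - softSymbolCompl L M β μ K (n + 1) (n + 1) p') : ℝ) : ℂ) * (((β * (L : ℝ) ^ 2 : ℝ) : ℂ) * propCT L M β μ K p')))) *
            (V j t ![((p, 0), 1), ((p', 1), 0), (((omega0 M, y), 0), 0), ((((omega0 M).rev, Qm - x), 1), 1)] *
              V j t ![((p, 0), 0), ((p', 1), 1), ((((omega0 M).rev, Qm - y), 1), 0), (((omega0 M, x), 0), 1)])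
        else 0‖ ≤
      (β * (L : ℝ) ^ 2) ^ 2 *
          (β * (L : ℝ) ^ 2 * klmsRowBound B.Dtmin A (4 + 8 / 3 * R.Gfr 1 * U ^ 2) A₀ LA β n (n + 2)
              (|-(2 * π / β)| + (4 + 8 / 3 * R.Gfr 1 * U ^ 2) * klTorusNorm L (Qm - x - y)) L +
            β * (L : ℝ) ^ 2 * klmsRowBound B.Dtmin A (4 + 8 / 3 * R.Gfr 1 * U ^ 2) A₀ LA β n (n + 2)
              (|2 * π / β| + (4 + 8 / 3 * R.Gfr 1 * U ^ 2) * klTorusNorm L (Qm - x - y)) L) +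
        ε * (256 / 3 * (β * (L : ℝ) ^ 2) ^ 2 / (klScale klE0 n + t * (klScale klE0 (n + 1) - klScale klE0 n)) ^ 2 *
          ∑ p : FreqMomentum L M, |softSymbolCompl L M β μ K (n + 1) (n + 2) p - softSymbolCompl L M β μ K (n + 1) (n + 1) p| * ‖propCT L M β μ K p‖) := by
  have hβ0 : 0 < β := lt_of_lt_of_le (by norm_num [klBetaMin]) hβ
  have hΛ1 := klth_klScale_pos (n + 1)
  -- the window `Λₙ₊₁/16` is inside the reduction threshold `Λ(t)/13`
  have hq' : (4 + 8 / 3 * R.Gfr 1 * U ^ 2) * klTorusNorm L (Qm - x - y) ≤ (klScale klE0 n + t * (klScale klE0 (n + 1) - klScale klE0 n)) / 13 := by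
    have := (scaleAt_mem n ht).1; linarith
  have hq8 : (4 + 8 / 3 * R.Gfr 1 * U ^ 2) * klTorusNorm L (Qm - x - y) ≤ klScale klE0 (n + 1) / 8 := by linarith
  rw [klms_weighted_crossed_eq_near β μ K hR hK hβ0 n hβn hj ht hq'
    (fun p => softSymbolCompl L M β μ K (n + 1) j p - softSymbolCompl L M β μ K (n + 1) (n + 1) p)
    (fun p => softSymbolCompl L M β μ K (n + 1) (n + 2) p - softSymbolCompl L M β μ K (n + 1) (n + 1) p) (fun k => by ring) Wd hWd]
  exact klms_dLine_adjacent_crossed_signed_le β μ K B hR hK hAb hA hA20 hμ n ht hβ hn hβn hM Wd hWd (fun _ => V j) (j := n + 2) (by omega) Qm x y hlo hhi hq8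
    hA0 hLA hε hY0B hY1B hY0A hY1A hflat

end Pinned

/-! ## §3 The readings in the ROOM's monomials -/

omit [NeZero M] in
/-- **The soft mass of the reduced `D`-line**: `klSoftMass n (s_{n+1,n+2} − s_{n+1,n+1}) ≤ 15367/4` (`= klIdxMass n (n+1)`; admissible frame, `klBetaMin ≤ β ≤ L`). -/
theorem klSoftMass_pinned_near_le {R : RenConsts} {U : ℝ} {N : ℕ} (hK : FrameOK R U N μ K) (hβ : klBetaMin ≤ β) (hβL : β ≤ L) (n : ℕ) :
    klSoftMass L M β μ K n (fun p => softSymbolCompl L M β μ K (n + 1) (n + 2) p - softSymbolCompl L M β μ K (n + 1) (n + 1) p) ≤ 15367 / 4 := by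
  have e : (fun p => softSymbolCompl L M β μ K (n + 1) (n + 2) p - softSymbolCompl L M β μ K (n + 1) (n + 1) p) =
      softSymbolCompl L M β μ K n (n + 2) - softSymbolCompl L M β μ K n (n + 1) := by
    rw [← softSymbolCompl_sub_compl_eq_sub β μ K (n + 1) n (n + 2) (n + 1)]; rfl
  rw [e]
  refine (klSoftMass_compl_sub_compl_le_klIdxMass β μ K hK hβ hβL (Nat.le_succ n) (by omega)).trans (le_of_eq ?_)
  unfold klIdxMass
  rw [show n + 1 - n = 1 by omega]
  norm_num

omit [NeZero M] in
/-- **The ε-remainder of the pinned rows in the door's normalisation**: for `C ≤ 512/3` (direct `512/3`, crossed `256/3`),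
`(Λₙ−Λₙ₊₁)((βL²)³)⁻¹·(ε·C(βL²)²/Λ(t)²·Σ|s_{n+1,n+2} − s_{n+1,n+1}|‖ĝ‖) ≤ ε·(512·15367)`. -/
theorem pinned_flat_le {R : RenConsts} {U : ℝ} {N : ℕ} (hK : FrameOK R U N μ K) (hβ : klBetaMin ≤ β) (hβL : β ≤ L) (n : ℕ) {t : ℝ} (ht : t ∈ Icc (0 : ℝ) 1)
    {ε C : ℝ} (hε : 0 ≤ ε) (hC : 0 ≤ C) (hC' : C ≤ 512 / 3) :
    (klScale klE0 n - klScale klE0 (n + 1)) * ((β * (L : ℝ) ^ 2) ^ 3)⁻¹ *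
        (ε * (C * (β * (L : ℝ) ^ 2) ^ 2 / (klScale klE0 n + t * (klScale klE0 (n + 1) - klScale klE0 n)) ^ 2 *
          ∑ p : FreqMomentum L M, |softSymbolCompl L M β μ K (n + 1) (n + 2) p - softSymbolCompl L M β μ K (n + 1) (n + 1) p| * ‖propCT L M β μ K p‖)) ≤
      ε * (512 * 15367) := by
  have hβ0 : 0 < β := lt_of_lt_of_le (by norm_num [klBetaMin]) hβ
  have h := klmsRoom_flat_le (L := L) (M := M) hβ0 μ K n ht
    (fun p => softSymbolCompl L M β μ K (n + 1) (n + 2) p - softSymbolCompl L M β μ K (n + 1) (n + 1) p) hε hC hC'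
  have hsm := klSoftMass_pinned_near_le (M := M) β μ K hK hβ hβL n
  refine h.trans ?_
  have : 2048 * klSoftMass L M β μ K n (fun p => softSymbolCompl L M β μ K (n + 1) (n + 2) p - softSymbolCompl L M β μ K (n + 1) (n + 1) p) ≤ 512 * 15367 := by
    linarith
  exact mul_le_mul_of_nonneg_left this hε

omit [NeZero M] in
/-- **EXACT READING of the pinned row at index `n+2`** (`(Λₙ₊₁/Λₙ₊₂)² = 16`, `16^{(n+2)−(n+1)} = 16`):
`(Λₙ − Λₙ₊₁)·klmsRowBound d A G A₀ L_A β n (n+2) δ L = (3/(2π))·(ZS⋆·Λₙ₊₁ + TH⋆·((π/β)/Λₙ₊₁) + TR⋆·((|0| + δ)/Λₙ₊₁)) + LAT⋆/L` with the closed constants displayed. -/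
theorem pinned_rowBound_reading (d A G A₀ La : ℝ) (n : ℕ) (δ : ℝ) :
    (klScale klE0 n - klScale klE0 (n + 1)) * klmsRowBound d A G A₀ La β n (n + 2) δ L =
      3 / (2 * π) *
          ((524288 / Real.pi * (64 * 16 + (2 * (448 / 3 * Real.exp 2) + 8) + 64) *
                (Real.pi * Real.sqrt 2 / (d - 4 * A) * (2 * La + 2 * A₀ * (2 / (1 / 10))) / (d - 4 * A) +
                  2 * A₀ * (1 / (d - 4 * A) ^ 2 + Real.pi * Real.sqrt 2 * (2 + 4 * A) / (d - 4 * A) ^ 3))) *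
              klScale klE0 (n + 1) +
            (393216 / Real.pi * (64 * 16 + (2 * (448 / 3 * Real.exp 2) + 8) + 64) *
                (2 * A₀ * (Real.pi * Real.sqrt 2 / (d - 4 * A)))) *
              ((Real.pi / β) / klScale klE0 (n + 1)) +
            (256 / Real.pi * 8 * (2 * A₀ * (Real.pi * Real.sqrt 2 / (d - 4 * A))) * (65 * (8 * (16 : ℝ)) + 17408 / 3 * 1)) *
              ((|(0 : ℝ)| + δ) / klScale klE0 (n + 1))) +
        96 * (512 * La / klScale klE0 (n + 1) +
            32 * A₀ * G * ((9 * (2 * (448 / 3 * Real.exp 2) + 8) + 4 * 8) + (65 * (8 * (16 : ℝ)) + 17408 / 3 * 1)) /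
              klScale klE0 (n + 1) ^ 2) / L := by
  have h16 : (klScale klE0 (n + 1) / klScale klE0 (n + 2)) ^ 2 = 16 := by
    rw [klth_klScale_succ (n + 1)]; have h := (klth_klScale_pos (n + 1)).ne'; field_simp; norm_num
  have hpow : (16 : ℝ) ^ (n + 2 - (n + 1)) = 16 := by rw [show n + 2 - (n + 1) = 1 by omega, pow_one]
  rw [klmsRowBound_reading, h16, hpow]

omit [NeZero L] [NeZero M] in
/-- In the forward window the transfer monomial IS the ROOM's `min` slot: `0 < r ≤ Λ₁ ⇒ r/Λ₁ = min(r/Λ₁, Λ₁/r)`. -/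
theorem div_eq_min_of_le {r Λ₁ : ℝ} (hr : 0 < r) (hrΛ : r ≤ Λ₁) : r / Λ₁ = min (r / Λ₁) (Λ₁ / r) := by
  have hΛ : 0 < Λ₁ := hr.trans_le hrΛ
  rw [min_eq_left]
  rw [div_le_div_iff₀ hΛ hr]
  nlinarith

omit [NeZero M] in
/-- **THE PINNED ROW IN THE ROOM's MONOMIALS** (`δ = G·r`, forward window `0 < r ≤ Λₙ₊₁`, `n ≤ n_β`, `klBetaMin ≤ β`, `0 < d − 4A`, `0 ≤ A`, `A₀, L_A ≥ 0`):
`2·(Λₙ−Λₙ₊₁)·Row_{n+2}(G·r) ≤ (3/π)·ZS⋆·klE0·(4ⁿ⁺¹)⁻¹ + (12/π)·TH⋆·(4^{n_β−n})⁻¹ + (3/π)·TR⋆·G·min(r/Λₙ₊₁, Λₙ₊₁/r) + 2·LAT⋆/L`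
— the ROOM's `(4ⁿ⁺¹)⁻¹·klIdxOverlap (n+1) (n+1)`, `3·thermalBar (n+1)`, `min_d` and `1/L` monomials of `transferBarRelIdx_succ_room` (this lineage's thermal dictionary
`(π/β)/Λₙ₊₁ ≤ 4·4^{−(n_β−n)}`, `klmsRoom_thermal_le`). -/
theorem pinned_row_le_slots {d A G A₀ La : ℝ} (hdA : 0 < d - 4 * A) (hA : 0 ≤ A) (hA0 : 0 ≤ A₀) (hLa : 0 ≤ La)
    (hβ : klBetaMin ≤ β) {n : ℕ} (hn : n ≤ nScales β) {r : ℝ} (hr : 0 < r) (hrΛ : r ≤ klScale klE0 (n + 1)) :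
    2 * ((klScale klE0 n - klScale klE0 (n + 1)) * klmsRowBound d A G A₀ La β n (n + 2) (G * r) L) ≤
      3 / π * (524288 / Real.pi * (64 * 16 + (2 * (448 / 3 * Real.exp 2) + 8) + 64) *
              (Real.pi * Real.sqrt 2 / (d - 4 * A) * (2 * La + 2 * A₀ * (2 / (1 / 10))) / (d - 4 * A) +
                2 * A₀ * (1 / (d - 4 * A) ^ 2 + Real.pi * Real.sqrt 2 * (2 + 4 * A) / (d - 4 * A) ^ 3))) *
          klE0 * ((4 : ℝ) ^ (n + 1))⁻¹ +
        12 / π * (393216 / Real.pi * (64 * 16 + (2 * (448 / 3 * Real.exp 2) + 8) + 64) * (2 * A₀ * (Real.pi * Real.sqrt 2 / (d - 4 * A)))) *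
          ((4 : ℝ) ^ (nScales β - n))⁻¹ +
        3 / π * (256 / Real.pi * 8 * (2 * A₀ * (Real.pi * Real.sqrt 2 / (d - 4 * A))) * (65 * (8 * (16 : ℝ)) + 17408 / 3 * 1)) *
          (G * min (r / klScale klE0 (n + 1)) (klScale klE0 (n + 1) / r)) +
        2 * (96 * (512 * La / klScale klE0 (n + 1) +
            32 * A₀ * G * ((9 * (2 * (448 / 3 * Real.exp 2) + 8) + 4 * 8) + (65 * (8 * (16 : ℝ)) + 17408 / 3 * 1)) /
              klScale klE0 (n + 1) ^ 2) / L) := by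
  have hπ := Real.pi_pos
  have hβ0 : 0 < β := lt_of_lt_of_le (by norm_num [klBetaMin]) hβ
  have hΛ1 := klth_klScale_pos (n + 1)
  rw [pinned_rowBound_reading]
  -- abbreviate the closed constants
  set ZS : ℝ := 524288 / Real.pi * (64 * 16 + (2 * (448 / 3 * Real.exp 2) + 8) + 64) *
      (Real.pi * Real.sqrt 2 / (d - 4 * A) * (2 * La + 2 * A₀ * (2 / (1 / 10))) / (d - 4 * A) +
        2 * A₀ * (1 / (d - 4 * A) ^ 2 + Real.pi * Real.sqrt 2 * (2 + 4 * A) / (d - 4 * A) ^ 3)) with hZS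
  set TH : ℝ := 393216 / Real.pi * (64 * 16 + (2 * (448 / 3 * Real.exp 2) + 8) + 64) * (2 * A₀ * (Real.pi * Real.sqrt 2 / (d - 4 * A))) with hTH
  set TR : ℝ := 256 / Real.pi * 8 * (2 * A₀ * (Real.pi * Real.sqrt 2 / (d - 4 * A))) * (65 * (8 * (16 : ℝ)) + 17408 / 3 * 1) with hTR
  set LAT : ℝ := 96 * (512 * La / klScale klE0 (n + 1) +
      32 * A₀ * G * ((9 * (2 * (448 / 3 * Real.exp 2) + 8) + 4 * 8) + (65 * (8 * (16 : ℝ)) + 17408 / 3 * 1)) / klScale klE0 (n + 1) ^ 2) with hLAT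
  obtain ⟨hZS0, hTH0, hTR0⟩ : 0 ≤ ZS ∧ 0 ≤ TH ∧ 0 ≤ TR := ⟨by rw [hZS]; positivity, by rw [hTH]; positivity, by rw [hTR]; positivity⟩
  -- the three dictionary lines
  have hΛeq : klScale klE0 (n + 1) = klE0 * ((4 : ℝ) ^ (n + 1))⁻¹ := rfl
  have hth := klmsRoom_thermal_le hβ hn
  have hmin : (|(0 : ℝ)| + G * r) / klScale klE0 (n + 1) = G * min (r / klScale klE0 (n + 1)) (klScale klE0 (n + 1) / r) := by
    rw [← div_eq_min_of_le hr hrΛ, abs_zero, zero_add, mul_div_assoc]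
  rw [hmin]
  have h1 : 3 / (2 * π) * (ZS * klScale klE0 (n + 1)) = 1 / 2 * (3 / π * ZS * klE0 * ((4 : ℝ) ^ (n + 1))⁻¹) := by rw [hΛeq]; ring
  have h2 : 3 / (2 * π) * (TH * ((Real.pi / β) / klScale klE0 (n + 1))) ≤ 1 / 2 * (12 / π * TH * ((4 : ℝ) ^ (nScales β - n))⁻¹) := by
    have := mul_le_mul_of_nonneg_left hth (by positivity : 0 ≤ 3 / (2 * π) * TH)
    calc 3 / (2 * π) * (TH * ((Real.pi / β) / klScale klE0 (n + 1))) = 3 / (2 * π) * TH * ((Real.pi / β) / klScale klE0 (n + 1)) := by ring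
      _ ≤ 3 / (2 * π) * TH * (4 * ((4 : ℝ) ^ (nScales β - n))⁻¹) := this
      _ = 1 / 2 * (12 / π * TH * ((4 : ℝ) ^ (nScales β - n))⁻¹) := by ring
  have h3 : 3 / (2 * π) * (TR * (G * min (r / klScale klE0 (n + 1)) (klScale klE0 (n + 1) / r))) =
      1 / 2 * (3 / π * TR * (G * min (r / klScale klE0 (n + 1)) (klScale klE0 (n + 1) / r))) := by ring
  have hsplit : 3 / (2 * π) * (ZS * klScale klE0 (n + 1) + TH * ((Real.pi / β) / klScale klE0 (n + 1)) + TR * (G * min (r / klScale klE0 (n + 1)) (klScale klE0 (n + 1) / r))) =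
      3 / (2 * π) * (ZS * klScale klE0 (n + 1)) + 3 / (2 * π) * (TH * ((Real.pi / β) / klScale klE0 (n + 1))) +
        3 / (2 * π) * (TR * (G * min (r / klScale klE0 (n + 1)) (klScale klE0 (n + 1) / r))) := by ring
  rw [hsplit, h1, h3]
  linarith

omit [NeZero M] in
/-- **THE SHIFTED PINNED ROW IN THE ROOM's MONOMIALS** (crossed row: `δ = |±2π/β| + G·r`; the bosonic shift is thermal, `(2π/β)/Λₙ₊₁ ≤ 8·4^{−(n_β−n)}`):
`2·(Λₙ−Λₙ₊₁)·Row_{n+2}(|±2π/β| + G·r) ≤ (3/π)·ZS⋆·klE0·(4ⁿ⁺¹)⁻¹ + (12/π)·(TH⋆ + 2·TR⋆)·(4^{n_β−n})⁻¹ + (3/π)·TR⋆·G·min(r/Λₙ₊₁, Λₙ₊₁/r) + 2·LAT⋆/L`. -/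
theorem pinned_row_le_slots_shift {d A G A₀ La : ℝ} (hdA : 0 < d - 4 * A) (hA : 0 ≤ A) (hG : 0 ≤ G) (hA0 : 0 ≤ A₀) (hLa : 0 ≤ La)
    (hβ : klBetaMin ≤ β) {n : ℕ} (hn : n ≤ nScales β) {r : ℝ} (hr : 0 < r) (hrΛ : r ≤ klScale klE0 (n + 1)) {s : ℝ} (hs : |s| = 2 * π / β) :
    2 * ((klScale klE0 n - klScale klE0 (n + 1)) * klmsRowBound d A G A₀ La β n (n + 2) (|s| + G * r) L) ≤
      3 / π * (524288 / Real.pi * (64 * 16 + (2 * (448 / 3 * Real.exp 2) + 8) + 64) *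
              (Real.pi * Real.sqrt 2 / (d - 4 * A) * (2 * La + 2 * A₀ * (2 / (1 / 10))) / (d - 4 * A) +
                2 * A₀ * (1 / (d - 4 * A) ^ 2 + Real.pi * Real.sqrt 2 * (2 + 4 * A) / (d - 4 * A) ^ 3))) *
          klE0 * ((4 : ℝ) ^ (n + 1))⁻¹ +
        12 / π * (393216 / Real.pi * (64 * 16 + (2 * (448 / 3 * Real.exp 2) + 8) + 64) * (2 * A₀ * (Real.pi * Real.sqrt 2 / (d - 4 * A))) +
            2 * (256 / Real.pi * 8 * (2 * A₀ * (Real.pi * Real.sqrt 2 / (d - 4 * A))) * (65 * (8 * (16 : ℝ)) + 17408 / 3 * 1))) *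
          ((4 : ℝ) ^ (nScales β - n))⁻¹ +
        3 / π * (256 / Real.pi * 8 * (2 * A₀ * (Real.pi * Real.sqrt 2 / (d - 4 * A))) * (65 * (8 * (16 : ℝ)) + 17408 / 3 * 1)) *
          (G * min (r / klScale klE0 (n + 1)) (klScale klE0 (n + 1) / r)) +
        2 * (96 * (512 * La / klScale klE0 (n + 1) +
            32 * A₀ * G * ((9 * (2 * (448 / 3 * Real.exp 2) + 8) + 4 * 8) + (65 * (8 * (16 : ℝ)) + 17408 / 3 * 1)) /
              klScale klE0 (n + 1) ^ 2) / L) := by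
  have hπ := Real.pi_pos
  have hβ0 : 0 < β := lt_of_lt_of_le (by norm_num [klBetaMin]) hβ
  have hΛ1 := klth_klScale_pos (n + 1)
  rw [pinned_rowBound_reading, hs]
  set ZS : ℝ := 524288 / Real.pi * (64 * 16 + (2 * (448 / 3 * Real.exp 2) + 8) + 64) *
      (Real.pi * Real.sqrt 2 / (d - 4 * A) * (2 * La + 2 * A₀ * (2 / (1 / 10))) / (d - 4 * A) +
        2 * A₀ * (1 / (d - 4 * A) ^ 2 + Real.pi * Real.sqrt 2 * (2 + 4 * A) / (d - 4 * A) ^ 3)) with hZS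
  set TH : ℝ := 393216 / Real.pi * (64 * 16 + (2 * (448 / 3 * Real.exp 2) + 8) + 64) * (2 * A₀ * (Real.pi * Real.sqrt 2 / (d - 4 * A))) with hTH
  set TR : ℝ := 256 / Real.pi * 8 * (2 * A₀ * (Real.pi * Real.sqrt 2 / (d - 4 * A))) * (65 * (8 * (16 : ℝ)) + 17408 / 3 * 1) with hTR
  set LAT : ℝ := 96 * (512 * La / klScale klE0 (n + 1) +
      32 * A₀ * G * ((9 * (2 * (448 / 3 * Real.exp 2) + 8) + 4 * 8) + (65 * (8 * (16 : ℝ)) + 17408 / 3 * 1)) / klScale klE0 (n + 1) ^ 2) with hLAT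
  obtain ⟨hZS0, hTH0, hTR0⟩ : 0 ≤ ZS ∧ 0 ≤ TH ∧ 0 ≤ TR := ⟨by rw [hZS]; positivity, by rw [hTH]; positivity, by rw [hTR]; positivity⟩
  have hΛeq : klScale klE0 (n + 1) = klE0 * ((4 : ℝ) ^ (n + 1))⁻¹ := rfl
  have hth := klmsRoom_thermal_le hβ hn
  set q : ℝ := ((4 : ℝ) ^ (nScales β - n))⁻¹ with hq
  set mn : ℝ := min (r / klScale klE0 (n + 1)) (klScale klE0 (n + 1) / r) with hmn
  have hsplit : (|(0 : ℝ)| + (2 * π / β + G * r)) / klScale klE0 (n + 1) = 2 * ((Real.pi / β) / klScale klE0 (n + 1)) + G * mn := by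
    rw [hmn, ← div_eq_min_of_le hr hrΛ, abs_zero, zero_add]
    field_simp
  rw [hsplit]
  have h1 : 3 / (2 * π) * (ZS * klScale klE0 (n + 1)) = 1 / 2 * (3 / π * ZS * klE0 * ((4 : ℝ) ^ (n + 1))⁻¹) := by rw [hΛeq]; ring
  have hth' : (Real.pi / β) / klScale klE0 (n + 1) ≤ 4 * q := hth
  have hth0 : 0 ≤ (Real.pi / β) / klScale klE0 (n + 1) := by positivity
  have hmn0 : 0 ≤ mn := by rw [hmn]; exact le_min (by positivity) (by positivity)
  have h2 : 3 / (2 * π) * (TH * ((Real.pi / β) / klScale klE0 (n + 1))) ≤ 1 / 2 * (12 / π * TH * q) := by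
    have := mul_le_mul_of_nonneg_left hth' (by positivity : 0 ≤ 3 / (2 * π) * TH)
    calc 3 / (2 * π) * (TH * ((Real.pi / β) / klScale klE0 (n + 1))) = 3 / (2 * π) * TH * ((Real.pi / β) / klScale klE0 (n + 1)) := by ring
      _ ≤ 3 / (2 * π) * TH * (4 * q) := this
      _ = 1 / 2 * (12 / π * TH * q) := by ring
  have h3 : 3 / (2 * π) * (TR * (2 * ((Real.pi / β) / klScale klE0 (n + 1)) + G * mn)) ≤ 1 / 2 * (12 / π * (2 * TR) * q) + 1 / 2 * (3 / π * TR * (G * mn)) := by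
    have := mul_le_mul_of_nonneg_left hth' (by positivity : 0 ≤ 3 / (2 * π) * TR * 2)
    calc 3 / (2 * π) * (TR * (2 * ((Real.pi / β) / klScale klE0 (n + 1)) + G * mn))
        = 3 / (2 * π) * TR * 2 * ((Real.pi / β) / klScale klE0 (n + 1)) + 1 / 2 * (3 / π * TR * (G * mn)) := by ring
      _ ≤ 3 / (2 * π) * TR * 2 * (4 * q) + 1 / 2 * (3 / π * TR * (G * mn)) := by linarith
      _ = 1 / 2 * (12 / π * (2 * TR) * q) + 1 / 2 * (3 / π * TR * (G * mn)) := by ring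
  have hsum : 3 / (2 * π) * (ZS * klScale klE0 (n + 1) + TH * ((Real.pi / β) / klScale klE0 (n + 1)) + TR * (2 * ((Real.pi / β) / klScale klE0 (n + 1)) + G * mn)) =
      3 / (2 * π) * (ZS * klScale klE0 (n + 1)) + 3 / (2 * π) * (TH * ((Real.pi / β) / klScale klE0 (n + 1))) +
        3 / (2 * π) * (TR * (2 * ((Real.pi / β) / klScale klE0 (n + 1)) + G * mn)) := by ring
  rw [hsum, h1]
  have e12 : 12 / π * (TH + 2 * TR) * q = 12 / π * TH * q + 12 / π * (2 * TR) * q := by ring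
  rw [e12]
  linarith

end Summit.HubbardSuperconductivity.HubbardSuperconductivity.Theorems.KLRegimeSplit

end
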